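import Summits.KontsevichZagierPeriods.KontsevichZagierPeriods.Theorems.RootDecompRelativeModAbsoluteCylLogSplitP12

/-! # `RootDecompRelativeModAbsoluteCylLogSplitP13` — part 13/25 of the mechanical ≤330-line split of `CylLogSplit.lean`
(split by the decomp-kz census seat for landing; mathematics unchanged; part 13 continues part 12). -/

noncomputable section
open Set MeasureTheory Filter Topology
open scoped BigOperators
open Literature.NumberTheory.Transcendental Literature.ModelTheory.ExponentialFields

namespace Summit.KontsevichZagierPeriods.RootDecompRelativeModAbsolute.Rung30571

namespace RegularisedLogLayer

namespace CylLog
variable {b : ℕ}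

/-- **Re-orientation of the pure-log cell by scaling** (`t = W s`): for `W > 0` differentiable on the open base,
`[band G 1 W⁻¹, h/s] − [band G W 1, h/t] ∈ KZ.relations`. -/
theorem logCell_reorient_mem_relations {b : ℕ} {G : Set (Fin b → ℝ)} {h W : (Fin b → ℝ) → ℝ}
    (hGo : IsOpen G) (hG : IsSemialgebraic ℚ G) (hW : IsSemialgebraicFunOn ℚ G W)
    (hWd : DifferentiableOn ℝ W G) (hW0 : ∀ x ∈ G, 0 < W x)
    (U U' : KZ.IntegralRep (b + 1))
    (hUd : U.domain = KZlog.band G (fun _ => 1) (fun x => (W x)⁻¹))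
    (hUi : EqOn U.integrand (fun z => h (Fin.init z) / z (Fin.last b)) U.domain)
    (hU'd : U'.domain = KZlog.band G W (fun _ => 1))
    (hU'i : EqOn U'.integrand (fun z => h (Fin.init z) / z (Fin.last b)) U'.domain) :
    KZ.of U - KZ.of U' ∈ KZ.relations := by
  refine KZ.of_sub_of_mem_relations_of_affine hGo (α := fun _ => 0) (β := W)
    (by simpa using isSemialgebraicFunOn_ratCast hG 0) hW (differentiableOn_const _) hWd hW0 U U'
    hUd hU'd (fun y _ => by ring) (fun y hy => by rw [zero_add, mul_inv_cancel₀ (hW0 y hy).ne'])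
    fun z hz => ?_
  have hz' : z ∈ KZlog.band G (fun _ => 1) (fun x => (W x)⁻¹) := hUd ▸ hz
  obtain ⟨hx, h1, h2⟩ := hz'
  have h1' : (1:ℝ) ≤ z (Fin.last b) := h1
  have h2' : z (Fin.last b) ≤ (W (Fin.init z))⁻¹ := h2
  have hWx : 0 < W (Fin.init z) := hW0 _ hx
  have hmem : (Fin.snoc (Fin.init z) (0 + W (Fin.init z) * z (Fin.last b)) : Fin (b + 1) → ℝ) ∈
      U'.domain := by
    rw [hU'd, KZlog.snoc_mem_band]
    refine ⟨hx, ?_, ?_⟩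
    · have h := le_mul_of_one_le_right hWx.le h1'
      simpa using h
    · have h : W (Fin.init z) * z (Fin.last b) ≤ W (Fin.init z) * (W (Fin.init z))⁻¹ :=
        mul_le_mul_of_nonneg_left h2' hWx.le
      rw [mul_inv_cancel₀ hWx.ne'] at h
      simpa using h
  rw [hUi hz, hU'i hmem]
  simp only [Fin.init_snoc, Fin.snoc_last, zero_add]
  have hz0 : z (Fin.last b) ≠ 0 := by positivity
  have hW0' : W (Fin.init z) ≠ 0 := hWx.ne'
  field_simp

/-! ### §3o The D7 HONESTY LEMMA — existence of a regularised cell from a base bound (PROVED)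
In glue step D7 the torus product is iterated along partial products `Π_j = ∏_{i≤j} W_i^{f_i}`; the intermediate cells
`P_m(q, Π_j)` are not given by the hypothesis and must be shown honest.  Since `∫_1^w |(t−1)^m/t| dt ≤ (w−1)^{m+1}` (`w ≥ 1`),
honesty follows from the single base condition `q·(Π−1)^{m+1} ∈ L¹(G)` — which is what order-raising to the common exponent
`m` (D6, `OneVarPowerBounds`) buys at a degenerate end. -/

/-- Fibre bound for the regularised kernel on `[1, w]`, `w ≥ 1`: `∫⁻_{[1,w]} ‖q (t−1)^m/t‖ ≤ ‖|q|·(w−1)^{m+1}‖`. -/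
theorem lintegral_regKernel_le_pow (m : ℕ) (q : ℝ) {w : ℝ} (hw : 1 ≤ w) :
    ∫⁻ t in Icc 1 w, ‖q * ((t - 1) ^ m / t)‖ₑ ≤ ‖|q| * (w - 1) ^ (m + 1)‖ₑ := by
  set g : ℝ → ℝ := fun t => q * ((t - 1) ^ m / t) with hg
  have hg_cont : ContinuousOn g (Icc 1 w) := by
    have h := continuousOn_scaled_kernel m q 1 (Icc 1 w)
      (fun t ht => (by linarith [ht.1] : (0:ℝ) < t).ne')
    simpa [hg] using h
  have hg_int : IntegrableOn g (Icc 1 w) := hg_cont.integrableOn_compact isCompact_Icc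
  have hL : ∫⁻ t in Icc 1 w, ‖g t‖ₑ = ENNReal.ofReal (∫ t in Icc 1 w, ‖g t‖) :=
    (ofReal_integral_norm_eq_lintegral_enorm hg_int).symm
  have hw0 : 0 ≤ w - 1 := by linarith
  have hK0 : 0 ≤ |q| * (w - 1) ^ (m + 1) := mul_nonneg (abs_nonneg _) (pow_nonneg hw0 _)
  show ∫⁻ t in Icc 1 w, ‖g t‖ₑ ≤ _
  rw [hL, Real.enorm_eq_ofReal hK0]
  refine ENNReal.ofReal_le_ofReal ?_
  have hpt : ∀ t ∈ Icc 1 w, ‖g t‖ ≤ |q| * (t - 1) ^ m := by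
    intro t ht
    have h0 : 0 ≤ t - 1 := by linarith [ht.1]
    have ht0 : 0 < t := by linarith [ht.1]
    simp only [hg, Real.norm_eq_abs, abs_mul, abs_div]
    rw [abs_of_nonneg (pow_nonneg h0 m), abs_of_pos ht0]
    exact mul_le_mul_of_nonneg_left (div_le_self (pow_nonneg h0 _) ht.1) (abs_nonneg q)
  have hcont2 : ContinuousOn (fun t : ℝ => |q| * (t - 1) ^ m) (Icc 1 w) := by fun_prop
  have hint2 : IntegrableOn (fun t : ℝ => |q| * (t - 1) ^ m) (Icc 1 w) :=
    hcont2.integrableOn_compact isCompact_Icc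
  have hsub : ∫ x in (1:ℝ)..w, (x - 1) ^ m = ∫ x in (1:ℝ) - 1..w - 1, x ^ m :=
    intervalIntegral.integral_comp_sub_right (fun t : ℝ => t ^ m) (1:ℝ)
  have hm1 : (1:ℝ) ≤ (m:ℝ) + 1 := by
    have := (Nat.cast_nonneg m : (0:ℝ) ≤ m)
    linarith
  calc ∫ t in Icc 1 w, ‖g t‖ ≤ ∫ t in Icc 1 w, |q| * (t - 1) ^ m :=
        setIntegral_mono_on hg_int.norm hint2 measurableSet_Icc hpt
    _ = |q| * ((w - 1) ^ (m + 1) / (m + 1)) := by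
        rw [integral_Icc_eq_integral_Ioc, ← intervalIntegral.integral_of_le hw,
          intervalIntegral.integral_const_mul, hsub, sub_self, integral_pow]
        simp
    _ ≤ |q| * (w - 1) ^ (m + 1) :=
        mul_le_mul_of_nonneg_left (div_le_self (pow_nonneg hw0 _) hm1) (abs_nonneg _)

/-- **D7 honesty lemma (`W ≥ 1`)**: for `ℚ`-semialgebraic `q, W` on `G` with `W ≥ 1` and `q·(W−1)^{m+1} ∈ L¹(G)`, the
regularised cell `P_m(q,W) = [band G 1 W, q (t−1)^m/t]` EXISTS as an honest representation (with exactly this integrand). -/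
theorem exists_regRep_of_integrableOn_pow {b m : ℕ} {G : Set (Fin b → ℝ)} {q W : (Fin b → ℝ) → ℝ}
    (hG : IsSemialgebraic ℚ G) (hq : IsSemialgebraicFunOn ℚ G q) (hW : IsSemialgebraicFunOn ℚ G W)
    (hW1 : ∀ x ∈ G, 1 ≤ W x) (hint : IntegrableOn (fun x => q x * (W x - 1) ^ (m + 1)) G) :
    ∃ R : KZ.IntegralRep (b + 1), R.domain = KZlog.band G (fun _ => 1) W ∧
      R.integrand = fun z => q (Fin.init z) * ((z (Fin.last b) - 1) ^ m / z (Fin.last b)) := by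
  have h1sa : IsSemialgebraicFunOn ℚ G (fun _ => (1:ℝ)) :=
    (isSemialgebraicFunOn_ratCast hG 1).congr fun _ _ => by simp
  have hbsa : IsSemialgebraic ℚ (KZlog.band G (fun _ => (1:ℝ)) W) := KZlog.isSemialgebraic_band h1sa hW
  have hGm : MeasurableSet G := hG.measurableSet_holds
  have hBm : MeasurableSet (KZlog.band G (fun _ => (1:ℝ)) W) := hbsa.measurableSet_holds
  have hband_sub : KZlog.band G (fun _ => (1:ℝ)) W ⊆ {z : Fin (b + 1) → ℝ | Fin.init z ∈ G} :=
    fun z hz => hz.1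
  have hqI : IsSemialgebraicFunOn ℚ (KZlog.band G (fun _ => (1:ℝ)) W) (fun z => q (Fin.init z)) :=
    hq.comp_init.mono hband_sub hbsa
  have hsI : IsSemialgebraicFunOn ℚ (KZlog.band G (fun _ => (1:ℝ)) W) (fun z => z (Fin.last b)) :=
    isSemialgebraicFunOn_apply hbsa (Fin.last b)
  have hs1 : IsSemialgebraicFunOn ℚ (KZlog.band G (fun _ => (1:ℝ)) W) (fun z => z (Fin.last b) - 1) :=
    (IsSemialgebraicFunOn.sub_holds hsI (isSemialgebraicFunOn_ratCast hbsa 1)).congr fun z _ => by simp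
  have hs0 : ∀ z ∈ KZlog.band G (fun _ => (1:ℝ)) W, z (Fin.last b) ≠ 0 := fun z hz => by
    have h1 : (1:ℝ) ≤ z (Fin.last b) := hz.2.1
    exact (by linarith : (0:ℝ) < z (Fin.last b)).ne'
  have hRsa : IsSemialgebraicFunOn ℚ (KZlog.band G (fun _ => (1:ℝ)) W)
      (fun z => q (Fin.init z) * ((z (Fin.last b) - 1) ^ m / z (Fin.last b))) :=
    IsSemialgebraicFunOn.mul_holds hqI
      (IsSemialgebraicFunOn.div (isSemialgebraicFunOn_pow' hbsa hs1 m) hsI hs0)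
  have hKn : IntegrableOn (fun x => ‖q x * (W x - 1) ^ (m + 1)‖) G := hint.norm
  have hK : IntegrableOn (fun x => |q x| * (W x - 1) ^ (m + 1)) G :=
    hKn.congr_fun (fun x hx => by
      show ‖q x * (W x - 1) ^ (m + 1)‖ = |q x| * (W x - 1) ^ (m + 1)
      rw [Real.norm_eq_abs, abs_mul, abs_of_nonneg (pow_nonneg (sub_nonneg.mpr (hW1 x hx)) (m + 1))]) hGm
  have hRint : IntegrableOn
      (fun z : Fin (b + 1) → ℝ => q (Fin.init z) * ((z (Fin.last b) - 1) ^ m / z (Fin.last b)))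
      (KZlog.band G (fun _ => (1:ℝ)) W) := by
    refine KZlog.integrableOn_band_of_lintegral_fibre_le hGm (a := fun _ => (1:ℝ)) (b := W) hBm
      (fun x t => KZlog.snoc_mem_band) (KZ.aestronglyMeasurable_of_isSemialgebraicFunOn hRsa hBm)
      (K := fun x => |q x| * (W x - 1) ^ (m + 1)) (fun x hx => ?_) hK
    simp only [Fin.init_snoc, Fin.snoc_last]
    exact lintegral_regKernel_le_pow m (q x) (hW1 x hx)
  exact ⟨{ domain := KZlog.band G (fun _ => (1:ℝ)) W
           integrand := fun z => q (Fin.init z) * ((z (Fin.last b) - 1) ^ m / z (Fin.last b))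
           isSemialgebraic_domain := hbsa
           isSemialgebraicFunOn_integrand := hRsa
           integrableOn := hRint }, rfl, rfl⟩

/-- Fibre bound for the regularised kernel on `[w, 1]`, `0 < w ≤ 1`:
`∫⁻_{[w,1]} ‖q (t−1)^m/t‖ ≤ ‖|q|·(1−w)^{m+1}/w‖`. -/
theorem lintegral_regKernel_le_pow' (m : ℕ) (q : ℝ) {w : ℝ} (hw0 : 0 < w) (hw : w ≤ 1) :
    ∫⁻ t in Icc w 1, ‖q * ((t - 1) ^ m / t)‖ₑ ≤ ‖|q| * (1 - w) ^ (m + 1) / w‖ₑ := by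
  set g : ℝ → ℝ := fun t => q * ((t - 1) ^ m / t) with hg
  have hg_cont : ContinuousOn g (Icc w 1) := by
    have h := continuousOn_scaled_kernel m q 1 (Icc w 1)
      (fun t ht => (lt_of_lt_of_le hw0 ht.1).ne')
    simpa [hg] using h
  have hg_int : IntegrableOn g (Icc w 1) := hg_cont.integrableOn_compact isCompact_Icc
  have hL : ∫⁻ t in Icc w 1, ‖g t‖ₑ = ENNReal.ofReal (∫ t in Icc w 1, ‖g t‖) :=
    (ofReal_integral_norm_eq_lintegral_enorm hg_int).symm
  have h1w : 0 ≤ 1 - w := by linarith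
  have hK0 : 0 ≤ |q| * (1 - w) ^ (m + 1) / w :=
    div_nonneg (mul_nonneg (abs_nonneg _) (pow_nonneg h1w _)) hw0.le
  show ∫⁻ t in Icc w 1, ‖g t‖ₑ ≤ _
  rw [hL, Real.enorm_eq_ofReal hK0]
  refine ENNReal.ofReal_le_ofReal ?_
  have hpt : ∀ t ∈ Icc w 1, ‖g t‖ ≤ |q| / w * (1 - t) ^ m := by
    intro t ht
    have h0 : 0 ≤ 1 - t := by linarith [ht.2]
    have ht0 : 0 < t := lt_of_lt_of_le hw0 ht.1
    simp only [hg, Real.norm_eq_abs, abs_mul, abs_div]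
    rw [abs_of_pos ht0,
      show |(t - 1) ^ m| = (1 - t) ^ m by rw [abs_pow, abs_sub_comm, abs_of_nonneg h0],
      mul_div_assoc', div_mul_eq_mul_div]
    exact div_le_div_of_nonneg_left (mul_nonneg (abs_nonneg _) (pow_nonneg h0 _)) hw0 ht.1
  have hcont2 : ContinuousOn (fun t : ℝ => |q| / w * (1 - t) ^ m) (Icc w 1) := by fun_prop
  have hint2 : IntegrableOn (fun t : ℝ => |q| / w * (1 - t) ^ m) (Icc w 1) :=
    hcont2.integrableOn_compact isCompact_Icc
  have hsub : ∫ x in w..(1:ℝ), (1 - x) ^ m = ∫ x in (1:ℝ) - 1..1 - w, x ^ m :=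
    intervalIntegral.integral_comp_sub_left (fun t : ℝ => t ^ m) (1:ℝ)
  have hm1 : (1:ℝ) ≤ (m:ℝ) + 1 := by
    have := (Nat.cast_nonneg m : (0:ℝ) ≤ m)
    linarith
  calc ∫ t in Icc w 1, ‖g t‖ ≤ ∫ t in Icc w 1, |q| / w * (1 - t) ^ m :=
        setIntegral_mono_on hg_int.norm hint2 measurableSet_Icc hpt
    _ = |q| / w * ((1 - w) ^ (m + 1) / (m + 1)) := by
        rw [integral_Icc_eq_integral_Ioc, ← intervalIntegral.integral_of_le hw,
          intervalIntegral.integral_const_mul, hsub, sub_self, integral_pow]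
        simp
    _ ≤ |q| / w * (1 - w) ^ (m + 1) :=
        mul_le_mul_of_nonneg_left (div_le_self (pow_nonneg h1w _) hm1)
          (div_nonneg (abs_nonneg _) hw0.le)
    _ = |q| * (1 - w) ^ (m + 1) / w := div_mul_eq_mul_div _ _ _

/-- **D7 honesty lemma (`0 < W ≤ 1`)**: for `ℚ`-semialgebraic `q, W` on `G` with `0 < W ≤ 1` and
`q·(1−W)^{m+1}/W ∈ L¹(G)`, the reversed regularised cell `[band G W 1, q (t−1)^m/t]` EXISTS as an honest representation. -/
theorem exists_regRep_of_integrableOn_pow' {b m : ℕ} {G : Set (Fin b → ℝ)} {q W : (Fin b → ℝ) → ℝ}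
    (hG : IsSemialgebraic ℚ G) (hq : IsSemialgebraicFunOn ℚ G q) (hW : IsSemialgebraicFunOn ℚ G W)
    (hW0 : ∀ x ∈ G, 0 < W x) (hW1 : ∀ x ∈ G, W x ≤ 1)
    (hint : IntegrableOn (fun x => q x * (1 - W x) ^ (m + 1) / W x) G) :
    ∃ R : KZ.IntegralRep (b + 1), R.domain = KZlog.band G W (fun _ => 1) ∧
      R.integrand = fun z => q (Fin.init z) * ((z (Fin.last b) - 1) ^ m / z (Fin.last b)) := by
  have h1sa : IsSemialgebraicFunOn ℚ G (fun _ => (1:ℝ)) :=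
    (isSemialgebraicFunOn_ratCast hG 1).congr fun _ _ => by simp
  have hbsa : IsSemialgebraic ℚ (KZlog.band G W (fun _ => (1:ℝ))) := KZlog.isSemialgebraic_band hW h1sa
  have hGm : MeasurableSet G := hG.measurableSet_holds
  have hBm : MeasurableSet (KZlog.band G W (fun _ => (1:ℝ))) := hbsa.measurableSet_holds
  have hband_sub : KZlog.band G W (fun _ => (1:ℝ)) ⊆ {z : Fin (b + 1) → ℝ | Fin.init z ∈ G} :=
    fun z hz => hz.1
  have hqI : IsSemialgebraicFunOn ℚ (KZlog.band G W (fun _ => (1:ℝ))) (fun z => q (Fin.init z)) :=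
    hq.comp_init.mono hband_sub hbsa
  have hsI : IsSemialgebraicFunOn ℚ (KZlog.band G W (fun _ => (1:ℝ))) (fun z => z (Fin.last b)) :=
    isSemialgebraicFunOn_apply hbsa (Fin.last b)
  have hs1 : IsSemialgebraicFunOn ℚ (KZlog.band G W (fun _ => (1:ℝ))) (fun z => z (Fin.last b) - 1) :=
    (IsSemialgebraicFunOn.sub_holds hsI (isSemialgebraicFunOn_ratCast hbsa 1)).congr fun z _ => by simp
  have hs0 : ∀ z ∈ KZlog.band G W (fun _ => (1:ℝ)), z (Fin.last b) ≠ 0 := fun z hz => by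
    have h1 : W (Fin.init z) ≤ z (Fin.last b) := hz.2.1
    exact (lt_of_lt_of_le (hW0 _ hz.1) h1).ne'
  have hRsa : IsSemialgebraicFunOn ℚ (KZlog.band G W (fun _ => (1:ℝ)))
      (fun z => q (Fin.init z) * ((z (Fin.last b) - 1) ^ m / z (Fin.last b))) :=
    IsSemialgebraicFunOn.mul_holds hqI
      (IsSemialgebraicFunOn.div (isSemialgebraicFunOn_pow' hbsa hs1 m) hsI hs0)
  have hKn : IntegrableOn (fun x => ‖q x * (1 - W x) ^ (m + 1) / W x‖) G := hint.norm
  have hK : IntegrableOn (fun x => |q x| * (1 - W x) ^ (m + 1) / W x) G :=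
    hKn.congr_fun (fun x hx => by
      show ‖q x * (1 - W x) ^ (m + 1) / W x‖ = |q x| * (1 - W x) ^ (m + 1) / W x
      rw [Real.norm_eq_abs, abs_div, abs_mul,
        abs_of_nonneg (pow_nonneg (sub_nonneg.mpr (hW1 x hx)) (m + 1)), abs_of_pos (hW0 x hx)]) hGm
  have hRint : IntegrableOn
      (fun z : Fin (b + 1) → ℝ => q (Fin.init z) * ((z (Fin.last b) - 1) ^ m / z (Fin.last b)))
      (KZlog.band G W (fun _ => (1:ℝ))) := by
    refine KZlog.integrableOn_band_of_lintegral_fibre_le hGm (a := W) (b := fun _ => (1:ℝ)) hBm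
      (fun x t => KZlog.snoc_mem_band) (KZ.aestronglyMeasurable_of_isSemialgebraicFunOn hRsa hBm)
      (K := fun x => |q x| * (1 - W x) ^ (m + 1) / W x) (fun x hx => ?_) hK
    simp only [Fin.init_snoc, Fin.snoc_last]
    exact lintegral_regKernel_le_pow' m (q x) (hW0 x hx) (hW1 x hx)
  exact ⟨{ domain := KZlog.band G W (fun _ => (1:ℝ))
           integrand := fun z => q (Fin.init z) * ((z (Fin.last b) - 1) ^ m / z (Fin.last b))
           isSemialgebraic_domain := hbsa
           isSemialgebraicFunOn_integrand := hRsa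
           integrableOn := hRint }, rfl, rfl⟩

/-! ### §3p D7 IN LEAN (positive orientation): the ITERATED torus product — PROVED
For `W₁,…,W_k ≥ 1` on an open base and honest cells `P_m(d, Wᵢ)`, the cell of the PRODUCT exists (honesty lemma §3o,
from the single base condition `d·(∏Wᵢ − 1)^{m+1} ∈ L¹`) and
`[P_m(d, ∏ Wᵢ)] − Σᵢ [P_m(d, Wᵢ)] − [G, d·(polyLog_m(∏ Wᵢ) − Σᵢ polyLog_m(Wᵢ))] ∈ KZ.relations`:
the base defects `ρ_m(Π_{<j}, W_j)` of the two-factor theorem TELESCOPE.  With an exact relation `∏ Wᵢ = 1` the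
product cell is EMPTY (null) and the base term is `−d·Σᵢ polyLog_m(Wᵢ)` — glue step D7 for this sign pattern. -/

/-- Auxiliary step `integral_regKernel_nonneg`. [bookkeeping] -/
theorem integral_regKernel_nonneg (m : ℕ) {w : ℝ} (hw : 1 ≤ w) :
    0 ≤ ∫ t in (1:ℝ)..w, (t - 1) ^ m / t :=
  intervalIntegral.integral_nonneg hw fun t ht =>
    div_nonneg (pow_nonneg (by linarith [ht.1]) _) (by linarith [ht.1])

/-- Auxiliary step `intervalIntegrable_regKernel`. [bookkeeping] -/
theorem intervalIntegrable_regKernel (m : ℕ) {a w : ℝ} (ha : 0 < a) (haw : a ≤ w) :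
    IntervalIntegrable (fun t : ℝ => (t - 1) ^ m / t) volume a w := by
  refine ContinuousOn.intervalIntegrable (ContinuousOn.div (by fun_prop) continuousOn_id fun u hu => ?_)
  rw [uIcc_of_le haw] at hu
  exact (ha.trans_le hu.1).ne'

/-- Auxiliary step `integral_regKernel_mono`. [bookkeeping] -/
theorem integral_regKernel_mono (m : ℕ) {a w : ℝ} (ha : 1 ≤ a) (haw : a ≤ w) :
    ∫ t in (1:ℝ)..a, (t - 1) ^ m / t ≤ ∫ t in (1:ℝ)..w, (t - 1) ^ m / t := by
  refine intervalIntegral.integral_mono_interval le_rfl ha haw ?_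
    (intervalIntegrable_regKernel m one_pos (ha.trans haw))
  filter_upwards [ae_restrict_mem measurableSet_Ioc] with t ht
  exact div_nonneg (pow_nonneg (by linarith [ht.1]) _) (by linarith [ht.1])

end CylLog
end RegularisedLogLayer
end Summit.KontsevichZagierPeriods.RootDecompRelativeModAbsolute.Rung30571
end
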